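import Summits.Ventures.HodgeRepro.Night3WeilModel
import Summits.Ventures.HodgeRepro.Night3CensusS4

/-!
# «S4 on the census representatives ⟹ S4» in every Weil model, generic over the sealer's engine

Blind re-derivation cell `pub-hodge-repro`, seat `night-3` (gen 3).  Imports night-3's `Night3WeilModel` (Lemma P's
product closure `WeilModel.alg_add` and cancellation `WeilModel.alg_cancel` as theorems of a `WeilModel`) and
`Night3CensusS4` (the generic `alg_of_reps`).  Namespace `HodgeRepro.Night3`.  The eleven sealed instances are in
`Night3WeilModelCensusRows`.

In a Weil model `X` over the multisets of CM types of a sealed Galois CM type `(Elt Γ, conj Γ)`, read `Alg M` as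
«`W_F(B_M)` is algebraic» = `X.W M ≤ X.Alg M`.  Lemma P is supplied by `X.alg_add` / `X.alg_cancel`; the remaining
hypotheses are `hpair` (Lefschetz (1,1) on the conjugate pairs), `htwist` (Galois twists preserve algebraicity:
`B_{M·g} = B_M` with `F` acting through `g`) and `hreps` — S4 on the corner products of the row's sealed representatives
(1 / 3, 4, 4, 6, 5, 3 / 20, 22, 26, 20 of them).  Conclusion: `W_F(B_M)` is algebraic for every zero-sum `M` — S4 for
every corner product of that Galois CM field, with the open input counted exactly as the sealed census counts it.
Nothing here closes S4; no sealed file is touched; no Tier-2 item depends on this file.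
-/

set_option autoImplicit false

namespace HodgeRepro.Night3

open Summit.Ventures.HodgeRepro.FaceCensus
open HodgeRepro.EngineBridge
open HodgeRepro.Night3.GSet
open HodgeRepro.Night3.Census
open scoped Pointwise

universe u

variable {K L : Type*} [Field K] [Field L] [Algebra K L] {ι : Type*} {n : ℕ}

/-- **«S4 on the representatives ⟹ S4» in a Weil model, generic**: `Γ` a Cayley table with `coversFaces Γ reps = true`,
`X` a Weil model over the multisets of subsets of `Elt Γ`; if the Weil spaces of the conjugate pairs (`hpair`), of the
twists of algebraic ones (`htwist`) and of the sealed representatives' corner products (`hreps`) are algebraic, then the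
Weil space of every zero-sum corner product is algebraic. -/
theorem WeilModel.alg_of_reps [Infinite K] [Fintype ι] (Γ : CMGaloisType n) [Fact (Γ.isCMGaloisType = true)]
    (reps : List (ℕ × ℕ × ℕ)) (hcov : coversFaces Γ reps = true)
    (X : WeilModel.{u} K L ι (Multiset (Finset (Elt Γ))))
    (hpair : ∀ Φ, IsCMType (Elt.conj Γ) Φ → X.W {Φ, Elt.conj Γ • Φ} ≤ X.Alg {Φ, Elt.conj Γ • Φ})
    (htwist : ∀ M g, X.W M ≤ X.Alg M → X.W (twistMul M g) ≤ X.Alg (twistMul M g))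
    (hreps : ∀ r ∈ reps, X.W (cornersMul Γ r) ≤ X.Alg (cornersMul Γ r))
    (M : Multiset (Finset (Elt Γ))) (hM : IsZeroSumG (Elt.conj Γ) M) : X.W M ≤ X.Alg M :=
  Census.alg_of_reps Γ reps hcov (fun N => X.W N ≤ X.Alg N)
    (fun M N _ _ => X.alg_add M N) (fun M N _ _ => X.alg_cancel M N) hpair htwist hreps M hM

end HodgeRepro.Night3
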